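import Summits.QuantumFields.BalabanUV.Beta.D1BFx.TorusJetSandwichArrays
import Summits.QuantumFields.BalabanUV.Beta.D1BFx.PeriodicArrayWrapLimit
import Summits.QuantumFields.BalabanUV.Beta.D1BFx.SortedEmbedding

/-!
# `BalabanUV.Beta.D1BFx.PackedPinnedLetters` — road «BF-x» for binder row D1, slot (K), chain step (I) «(A1)-PACKED», brick «COFRAME-PACK-2»
# (the twisted MIXED co-frame weight jet at response-packed jets), FILE P1: **THE RESPONSE-WEIGHTED PINNED BOND WORDS OF THE TORUS ARE PERIODISED
# ARRAYS** — the packed twins of 3b-β `TorusJetSandwichArrays.Djet_mul_Yhat_mul_Dhat_transpose ∕ Dhat_mul_Yhat_mul_Djet_transpose`: with the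
# RESPONSE-WEIGHTED TIP JET `Ê[ρ] := Σ_b ρ_b • Ê_b = tipW s ρ` (the packed gauge direction of THE CONVENTION, `ρ_b` = the torus response at the bond `b`,
# i.e. the PERIODISED p-free weight `ω α x̃ = Σ'_t w α (x̃ + s·t)`) and any jointly `s`-periodic row-summable site kernel `Y`:
# `Ê[ρ]·Ŷ·D̂ᵀ = (toF (jetRw ω Y))^`, `D̂·Ŷ·Ê[ρ]ᵀ = (toF (jetCw ω Y))^`, `Ê[ρ]·Ŷ·Ê[ρ′]ᵀ = (toF (jetRCw ω ω′ Y))^` — EXACT on every torus — and the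
# periodised-weight kernels are the ARRAYS of the plain-weight ones: `jetRw ω^{(s)} Y = arr s (jetRw w Y)` (one weight stays PLAIN inside the array:
# F-g16-1 «WRAP» in its pinned form), which are uniformly bi-localised and converge entrywise

HONEST DEPENDENCY (cell records, verbatim): «continuum YM on T⁴ ⇐ BetaPertH ∧ nine spine estimates (0/9 proved); BetaPertH ⇐ (D1) ∧ (D4) ∧
CAP+tail; G-an2-4 gates asym, D1 and NE2/3/4.»  HONEST FRAMING (cell contract, verbatim): «discharging `BetaPertH` makes Bałaban's UV stability
UNCONDITIONAL — a real constructive-QFT result; it is NOT the continuum limit and NOT the Clay problem.»  THIS MODULE DISCHARGES NOTHING of (K),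
of D1 or of the wall: [our object] four kernel ∕ matrix DEFINITIONS (asserting nothing) and [folklore] array calculus over 3b-β `TorusJetSandwichArrays`
(`tsum_col_images`, `summable_col_images`), TA2 `PeriodicArrays`, `TorusCoframeJets` (`Djet`, `tip`, `Dhat_apply_eq`), gan24-leaf-05's
`PeriodicArrayWrapLimit` (`summable_images_weight`, `abs_tsum_images_le`, `tendsto_tsum_images`) BY NAME.  No `def … : Prop`, nothing cited, 0 sorry.
0∕4 binders of row D1; (K) NOT closed; NOT D1, NOT BetaPertH, NOT continuum, NOT Clay.

ABSOLUTE RULE (cell charter, verbatim): «No internally-minted statement may enter as a cited fact. Every hypothesis is either kernel-proved in this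
package or a verbatim quotation of a PUBLISHED theorem with page reference. The manuscript(s) under audit are NOT citable for their own disputed
steps — they are the thing under adjudication; programme-internal (2001/route/tribunal) claims are never citable.»

CONTENT:
* §1 [our object] `tipW s ρ` (response-weighted tip jet); `sum_smul_Djet_eq_tipW` (`Σ_i r i • Ê_{e₁ i} = tipW s (r ∘ e₁⁻¹)`), `resp_symm_e₁` (the response
  at `e₁⁻¹ b` in window form).
* §2 [our objects] `jetRw ω Y`, `jetCw ω Y`, `jetRCw ω ω′ Y`; `arr_jetRw`, `arr_jetCw`, `arr_jetRCw` (arrays ↔ periodised weights).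
* §3 the three torus letters `tipW_mul_Yhat_mul_Dhat_transpose`, `Dhat_mul_Yhat_mul_tipW_transpose`, `tipW_mul_Yhat_mul_tipW_transpose`.
* Localisation ((u1)) and entrywise limits ((u2)) of the three kernels: the sequel `PackedPinnedLettersLoc`.
Unit `b2b-balaban-beta-d1-formalise-leaf-03` (gen 23); road owner `b2b-balaban-beta-d1-p2` (W-d1p2-g18-4∕-5, journal l.40583).
-/

noncomputable section

namespace Summit.QuantumFields.BalabanUV.Beta.D1BFx.PackedPinnedLetters

open Matrix Filter Topology
open scoped BigOperators
open Literature.Probability.LatticeModels (TorusSite)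
open Literature.MathematicalPhysics.QuantumFieldTheory.Balaban1983to89
open Literature.MathematicalPhysics.QuantumFieldTheory.Balaban1983to89.Beta
open B12Sec2to5 (l1 l1_nonneg)
open ExpKernelCalculus (MKer BiLoc Decays Zl shiftK l1_sub_triangle)
open AffineAveraging (unitVec)
open Summit.QuantumFields.BalabanUV.Beta.D1BFx.PeriodicArrays (arr arr_apply toF Kfib_toF periodic_of_shiftK imageShift_eq_add_smul)
open Summit.QuantumFields.BalabanUV.Beta.D1BFx.FibredPeriodisation (Kfib periodiseF periodiseF_apply)
open Summit.QuantumFields.BalabanUV.Beta.D1BFx.SortedReblocking (torusBlockEquiv)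
open Summit.QuantumFields.BalabanUV.Beta.D1BFx.SortedEmbedding (e₁ e₁_apply)
open Summit.QuantumFields.BalabanUV.Beta.D1BFx.TorusHodgeWeight (Dhat)
open Summit.QuantumFields.BalabanUV.Beta.D1BFx.TorusCoframeJets (tip Djet Djet_apply Dhat_apply_eq)
open Summit.QuantumFields.BalabanUV.Beta.D1BFx.TorusJetSandwichArrays (tsum_col_images summable_col_images isPeriodic₂_Kfib summable_Kfib_row)
open Summit.QuantumFields.BalabanUV.Beta.D1BFx.GhostStencil (l1_unitVec l1_zero)
open Summit.QuantumFields.BalabanUV.Beta.D1BFx.PeriodicArrayWrapLimit (summable_images_weight abs_tsum_images_le tendsto_tsum_images)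

variable (s : ℕ) [NeZero s]

/-! ## §1 The response-weighted tip jet -/

section TipW

/-- [our object] **THE RESPONSE-WEIGHTED TIP JET** `tipW s ρ := Σ_b ρ_b • Ê_b`: rows = torus bonds, columns = torus sites, entry `ρ b·[z = tip b]` —
THE CONVENTION's gauge direction packed by the responses `ρ`.  A definition; asserts nothing. -/
def tipW (ρ : Site 4 s × Fin 4 → ℝ) : Matrix (Site 4 s × Fin 4) (Site 4 s) ℝ := Matrix.of fun b z => if z = tip s b then ρ b else 0

omit [NeZero s] in
/-- [our object] Unfolding `tipW`. -/
@[simp] theorem tipW_apply (ρ : Site 4 s × Fin 4 → ℝ) (b : Site 4 s × Fin 4) (z : Site 4 s) :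
    tipW s ρ b z = if z = tip s b then ρ b else 0 := rfl

variable (n p : ℕ) [NeZero n] [NeZero p]

/-- [folklore] **THE RESPONSE-PACKED SUM OF THE CONVENTION's TIP JETS IS `tipW`**: `Σ_i r i • Ê_{e₁ i} = tipW (n·p) (r ∘ e₁⁻¹)`. -/
theorem sum_smul_Djet_eq_tipW (r : Beta.Site 4 p × (TorusSite 4 n × Fin 4) → ℝ) :
    ∑ i, r i • Djet (n * p) (e₁ n p i) = tipW (n * p) (fun b => r ((e₁ n p).symm b)) := by
  ext b z
  rw [Matrix.sum_apply, tipW_apply, Finset.sum_eq_single ((e₁ n p).symm b)]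
  · rw [Matrix.smul_apply, Djet_apply, Equiv.apply_symm_apply, smul_eq_mul]
    by_cases h : z = tip (n * p) b
    · rw [if_pos ⟨rfl, h⟩, if_pos h, mul_one]
    · rw [if_neg (fun hh => h hh.2), if_neg h, mul_zero]
  · intro i _ hi
    rw [Matrix.smul_apply, Djet_apply, if_neg, smul_zero]
    rintro ⟨hb, -⟩
    exact hi (by rw [hb, Equiv.symm_apply_apply])
  · intro h; exact absurd (Finset.mem_univ _) h

/-- [folklore] **THE RESPONSE AT THE BOND `e₁⁻¹ b` IN WINDOW FORM**: if `r i = Σ'_t w κ′_i (ŵ_i + (n·p)·t)` (the letter `hrₛ` of (B6′)) then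
`r (e₁⁻¹ b) = Σ'_t w b.2 (windowMap b.1 + (n·p)·t)` — the PERIODISED weight at the window representative of the torus bond `b`. -/
theorem resp_symm_e₁ (w : Fin 4 → (Fin 4 → ℤ) → ℝ) (r : Beta.Site 4 p × (TorusSite 4 n × Fin 4) → ℝ)
    (hr : ∀ i, r i = ∑' t : Fin 4 → ℤ, w i.2.2 (imageShift (n * p) (windowMap 4 (n * p) (torusBlockEquiv n p (i.1, i.2.1))) t))
    (b : Beta.Site 4 (n * p) × Fin 4) :
    r ((e₁ n p).symm b) = ∑' t : Fin 4 → ℤ, w b.2 (imageShift (n * p) (windowMap 4 (n * p) b.1) t) := by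
  have hb : e₁ n p ((e₁ n p).symm b) = b := Equiv.apply_symm_apply _ _
  have he : e₁ n p ((e₁ n p).symm b) = (torusBlockEquiv n p (((e₁ n p).symm b).1, ((e₁ n p).symm b).2.1), ((e₁ n p).symm b).2.2) := rfl
  rw [he] at hb
  have h1 : torusBlockEquiv n p (((e₁ n p).symm b).1, ((e₁ n p).symm b).2.1) = b.1 := congrArg Prod.fst hb
  have h2 : ((e₁ n p).symm b).2.2 = b.2 := congrArg Prod.snd hb
  rw [hr, h1, h2]

end TipW

/-! ## §2 The weighted pinned `ℤ⁴` bond kernels and their arrays -/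

section Kernels

/-- [our object] **THE ROW-WEIGHTED PINNED WORD** `jetRw ω Y (x,α) (z,β) := ω α x · (Y (x+e_α) (z+e_β) − Y (x+e_α) z)` (`= Σ_b ω_b • jetR b Y`, the
response-weighted `Ḋ∘Y∘dᵀ`).  A definition; asserts nothing. -/
def jetRw (ω : Fin 4 → (Fin 4 → ℤ) → ℝ) (Y : MKer 4 Unit) : MKer 4 (Fin 4) := fun x z α β =>
  ω α x * (Y (x + unitVec α) (z + unitVec β) () () - Y (x + unitVec α) z () ())

/-- [our object] **THE COLUMN-WEIGHTED PINNED WORD** `jetCw ω Y (x,α) (z,β) := ω β z · (Y (x+e_α) (z+e_β) − Y x (z+e_β))` (`d∘Y∘Ḋᵀ` weighted).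
A definition; asserts nothing. -/
def jetCw (ω : Fin 4 → (Fin 4 → ℤ) → ℝ) (Y : MKer 4 Unit) : MKer 4 (Fin 4) := fun x z α β =>
  ω β z * (Y (x + unitVec α) (z + unitVec β) () () - Y x (z + unitVec β) () ())

/-- [our object] **THE DOUBLY WEIGHTED TWO-TIP TABLE** `jetRCw ω ω′ Y (x,α) (z,β) := ω α x · ω′ β z · Y (x+e_α) (z+e_β)` (`Ḋ∘Y∘Ḋᵀ` weighted on
both sides).  A definition; asserts nothing. -/
def jetRCw (ω ω' : Fin 4 → (Fin 4 → ℤ) → ℝ) (Y : MKer 4 Unit) : MKer 4 (Fin 4) := fun x z α β =>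
  ω α x * ω' β z * Y (x + unitVec α) (z + unitVec β) () ()

variable (ω ω' : Fin 4 → (Fin 4 → ℤ) → ℝ) (Y : MKer 4 Unit)

omit [NeZero s] in
/-- [our object] Unfolding `jetRw`. -/
@[simp] theorem jetRw_apply (x z : Fin 4 → ℤ) (α β : Fin 4) :
    jetRw ω Y x z α β = ω α x * (Y (x + unitVec α) (z + unitVec β) () () - Y (x + unitVec α) z () ()) := rfl

omit [NeZero s] in
/-- [our object] Unfolding `jetCw`. -/
@[simp] theorem jetCw_apply (x z : Fin 4 → ℤ) (α β : Fin 4) :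
    jetCw ω Y x z α β = ω β z * (Y (x + unitVec α) (z + unitVec β) () () - Y x (z + unitVec β) () ()) := rfl

omit [NeZero s] in
/-- [our object] Unfolding `jetRCw`. -/
@[simp] theorem jetRCw_apply (x z : Fin 4 → ℤ) (α β : Fin 4) :
    jetRCw ω ω' Y x z α β = ω α x * ω' β z * Y (x + unitVec α) (z + unitVec β) () () := rfl

variable {ω ω' Y}

omit [NeZero s] in
/-- [folklore] A jointly `s`-periodic kernel, shifted in both variables by `s·t` and then by unit vectors. -/
theorem periodic_shift_unit (hper : ∀ t : Fin 4 → ℤ, shiftK ((s : ℤ) • t) Y = Y) (x z t : Fin 4 → ℤ) (e e' : Fin 4 → ℤ) :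
    Y (imageShift s x t + e) (imageShift s z t + e') () () = Y (x + e) (z + e') () () := by
  rw [add_comm (imageShift s x t), add_imageShift, add_comm (imageShift s z t), add_imageShift, add_comm e, add_comm e']
  exact periodic_of_shiftK hper _ _ t () ()

omit [NeZero s] in
/-- [folklore] … with the unit vector on the first variable only. -/
theorem periodic_shift_unit_left (hper : ∀ t : Fin 4 → ℤ, shiftK ((s : ℤ) • t) Y = Y) (x z t : Fin 4 → ℤ) (e : Fin 4 → ℤ) :
    Y (imageShift s x t + e) (imageShift s z t) () () = Y (x + e) z () () := by
  have h := periodic_shift_unit s hper x z t e 0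
  rwa [add_zero, add_zero] at h

omit [NeZero s] in
/-- [folklore] … with the unit vector on the second variable only. -/
theorem periodic_shift_unit_right (hper : ∀ t : Fin 4 → ℤ, shiftK ((s : ℤ) • t) Y = Y) (x z t : Fin 4 → ℤ) (e' : Fin 4 → ℤ) :
    Y (imageShift s x t) (imageShift s z t + e') () () = Y x (z + e') () () := by
  have h := periodic_shift_unit s hper x z t 0 e'
  rwa [add_zero, add_zero] at h

omit [NeZero s] in
/-- [folklore] **THE ARRAY OF THE ROW-WEIGHTED WORD PERIODISES THE WEIGHT**: for jointly `s`-periodic `Y` and any weight `w`,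
`arr s (jetRw w Y) = jetRw (fun α x => Σ'_t w α (x + s·t)) Y` — the one PLAIN weight inside the array becomes the torus response
(`tsum_mul_right`; no summability needed). -/
theorem arr_jetRw (w : Fin 4 → (Fin 4 → ℤ) → ℝ) (hper : ∀ t : Fin 4 → ℤ, shiftK ((s : ℤ) • t) Y = Y) :
    arr s (jetRw w Y) = jetRw (fun α x => ∑' t : Fin 4 → ℤ, w α (imageShift s x t)) Y := by
  funext x z α β
  rw [arr_apply, jetRw_apply]
  simp only [jetRw_apply, periodic_shift_unit s hper, periodic_shift_unit_left s hper]
  exact tsum_mul_right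

omit [NeZero s] in
/-- [folklore] **THE ARRAY OF THE COLUMN-WEIGHTED WORD**: `arr s (jetCw w Y) = jetCw (fun β z => Σ'_t w β (z + s·t)) Y`. -/
theorem arr_jetCw (w : Fin 4 → (Fin 4 → ℤ) → ℝ) (hper : ∀ t : Fin 4 → ℤ, shiftK ((s : ℤ) • t) Y = Y) :
    arr s (jetCw w Y) = jetCw (fun β z => ∑' t : Fin 4 → ℤ, w β (imageShift s z t)) Y := by
  funext x z α β
  rw [arr_apply, jetCw_apply]
  simp only [jetCw_apply, periodic_shift_unit s hper, periodic_shift_unit_right s hper]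
  exact tsum_mul_right

omit [NeZero s] in
/-- [folklore] **THE ARRAY OF THE TWO-TIP TABLE WITH ONE WEIGHT PERIODISED** (F-g16-1's diagonal form): for `s`-periodic `ω′` and jointly periodic `Y`,
`arr s (jetRCw w ω′ Y) = jetRCw (fun α x => Σ'_t w α (x + s·t)) ω′ Y`. -/
theorem arr_jetRCw (w : Fin 4 → (Fin 4 → ℤ) → ℝ) (hper : ∀ t : Fin 4 → ℤ, shiftK ((s : ℤ) • t) Y = Y)
    (hω' : ∀ β z t, ω' β (imageShift s z t) = ω' β z) :
    arr s (jetRCw w ω' Y) = jetRCw (fun α x => ∑' t : Fin 4 → ℤ, w α (imageShift s x t)) ω' Y := by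
  funext x z α β
  rw [arr_apply, jetRCw_apply]
  simp only [jetRCw_apply, periodic_shift_unit s hper, hω', mul_assoc]
  exact tsum_mul_right

omit [NeZero s] in
/-- [folklore] The periodised weight `x ↦ Σ'_t w α (x + s·t)` is `s`-periodic (re-index the images). -/
theorem tsum_images_periodic (w : Fin 4 → (Fin 4 → ℤ) → ℝ) (β : Fin 4) (z t : Fin 4 → ℤ) :
    (∑' t' : Fin 4 → ℤ, w β (imageShift s (imageShift s z t) t')) = ∑' t' : Fin 4 → ℤ, w β (imageShift s z t') := by
  have e : ∀ t' : Fin 4 → ℤ, imageShift s (imageShift s z t) t' = imageShift s z ((Equiv.addLeft t) t') := fun t' => by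
    funext i; simp only [imageShift, Equiv.coe_addLeft, Pi.add_apply]; ring
  simp only [e]
  exact (Equiv.addLeft t).tsum_eq (fun t' => w β (imageShift s z t'))

end Kernels

/-! ## §3 The three torus letters -/

section Letters

/-- [folklore] `tip (x̄, α) = σ(x̃ + e_α)`. -/
theorem tip_eq_siteOf (x : Site 4 s) (α : Fin 4) : tip s (x, α) = siteOf 4 s (windowMap 4 s x + unitVec α) := by
  rw [tip, siteOf_add, siteOf_windowMap]

/-- [folklore] `x̄ + σ e = σ(x̃ + e)`. -/
theorem add_siteOf_eq (x : Site 4 s) (e : Fin 4 → ℤ) : x + siteOf 4 s e = siteOf 4 s (windowMap 4 s x + e) := by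
  rw [siteOf_add, siteOf_windowMap]

variable {Y : MKer 4 Unit} (hperY : IsPeriodic₂ s (Kfib (toF Y) () ())) (hrowY : ∀ q, Summable (Kfib (toF Y) () () q))
  (ω ω' : Fin 4 → (Fin 4 → ℤ) → ℝ) {ρ ρ' : Site 4 s × Fin 4 → ℝ}
  (hρ : ∀ b, ρ b = ω b.2 (windowMap 4 s b.1)) (hρ' : ∀ b, ρ' b = ω' b.2 (windowMap 4 s b.1))
include hperY hrowY

/-- [folklore] Column images of `Y` shifted by a unit vector on the right: `Σ'_n Y q (z̃ + s·n + e) = Ŷ (σq) (z̄ + σe)`. -/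
theorem tsum_col_images_shift (q : Fin 4 → ℤ) (z : Site 4 s) (e : Fin 4 → ℤ) :
    (∑' m : Fin 4 → ℤ, Y q (imageShift s (windowMap 4 s z) m + e) () ()) = periodise₂ s (Kfib (toF Y) () ()) (siteOf 4 s q) (z + siteOf 4 s e) := by
  have e1 : ∀ m : Fin 4 → ℤ, imageShift s (windowMap 4 s z) m + e = imageShift s (windowMap 4 s z + e) m := fun m => by
    rw [add_comm, add_imageShift, add_comm]
  simp only [e1]
  rw [add_siteOf_eq]
  exact tsum_col_images s hperY hrowY q (windowMap 4 s z + e)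

/-- [folklore] Column images of `Y`: `Σ'_n Y q (z̃ + s·n) = Ŷ (σq) z̄`. -/
theorem tsum_col_images_rep (q : Fin 4 → ℤ) (z : Site 4 s) :
    (∑' m : Fin 4 → ℤ, Y q (imageShift s (windowMap 4 s z) m) () ()) = periodise₂ s (Kfib (toF Y) () ()) (siteOf 4 s q) z := by
  have h := tsum_col_images s hperY hrowY q (windowMap 4 s z)
  rwa [siteOf_windowMap] at h

include hρ in
/-- [folklore] **`Ê[ρ]·Ŷ·D̂ᵀ = (toF (jetRw ω Y))^`**: the response-weighted row-pinned word of the torus is the fibrewise periodisation of the `ℤ⁴`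
kernel `jetRw ω Y` — for ANY jointly `s`-periodic row-summable `Y` and responses `ρ b = ω b.2 b̃.1` (no hypothesis on `ω`). -/
theorem tipW_mul_Yhat_mul_Dhat_transpose :
    tipW s ρ * Matrix.of (periodise₂ s (Kfib (toF Y) () ())) * (Dhat 4 s)ᵀ = Matrix.of (periodiseF s (toF (jetRw ω Y))) := by
  have hsY : ∀ q q' : Fin 4 → ℤ, Summable fun m => Y q (imageShift s q' m) () () := fun q q' => summable_col_images s hrowY q q'
  have hsY' : ∀ (q q' e : Fin 4 → ℤ), Summable fun m => Y q (imageShift s q' m + e) () () := fun q q' e =>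
    (hsY q (q' + e)).congr fun m => by rw [add_comm q' e, ← add_imageShift, add_comm]
  ext ⟨x, α⟩ ⟨z, β⟩
  -- the torus side
  have lhs : (tipW s ρ * Matrix.of (periodise₂ s (Kfib (toF Y) () ())) * (Dhat 4 s)ᵀ) (x, α) (z, β)
      = ρ (x, α) * (periodise₂ s (Kfib (toF Y) () ()) (tip s (x, α)) (z + siteOf 4 s (unitVec β))
            - periodise₂ s (Kfib (toF Y) () ()) (tip s (x, α)) z) := by
    rw [Matrix.mul_assoc, Matrix.mul_apply, Finset.sum_eq_single (tip s (x, α))]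
    · rw [tipW_apply, if_pos rfl, Matrix.mul_apply]
      simp only [Matrix.of_apply, Matrix.transpose_apply, Dhat_apply_eq, mul_sub, mul_ite, mul_one, mul_zero, Finset.sum_sub_distrib,
        Finset.sum_ite_eq', Finset.mem_univ, if_true]
    · intro z' _ hz'
      rw [tipW_apply, if_neg hz', zero_mul]
    · intro h; exact absurd (Finset.mem_univ _) h
  -- the array side
  have rhs : periodiseF s (toF (jetRw ω Y)) (x, α) (z, β)
      = ω α (windowMap 4 s x) * (periodise₂ s (Kfib (toF Y) () ()) (siteOf 4 s (windowMap 4 s x + unitVec α)) (z + siteOf 4 s (unitVec β))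
            - periodise₂ s (Kfib (toF Y) () ()) (siteOf 4 s (windowMap 4 s x + unitVec α)) z) := by
    rw [periodiseF_apply]
    show (∑' m : Fin 4 → ℤ, jetRw ω Y (windowMap 4 s x) (imageShift s (windowMap 4 s z) m) α β) = _
    simp only [jetRw_apply]
    rw [tsum_mul_left, Summable.tsum_sub (hsY' _ _ _) (hsY _ _), tsum_col_images_shift s hperY hrowY, tsum_col_images_rep s hperY hrowY]
  rw [lhs, Matrix.of_apply, rhs, hρ, tip_eq_siteOf]

include hρ in
/-- [folklore] **`D̂·Ŷ·Ê[ρ]ᵀ = (toF (jetCw ω Y))^`** for an `s`-PERIODIC weight `ω` (the torus response read at window representatives). -/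
theorem Dhat_mul_Yhat_mul_tipW_transpose (hω : ∀ β z t, ω β (imageShift s z t) = ω β z) :
    Dhat 4 s * Matrix.of (periodise₂ s (Kfib (toF Y) () ())) * (tipW s ρ)ᵀ = Matrix.of (periodiseF s (toF (jetCw ω Y))) := by
  have hsY : ∀ q q' : Fin 4 → ℤ, Summable fun m => Y q (imageShift s q' m) () () := fun q q' => summable_col_images s hrowY q q'
  have hsY' : ∀ (q q' e : Fin 4 → ℤ), Summable fun m => Y q (imageShift s q' m + e) () () := fun q q' e =>
    (hsY q (q' + e)).congr fun m => by rw [add_comm q' e, ← add_imageShift, add_comm]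
  ext ⟨x, α⟩ ⟨z, β⟩
  have lhs : (Dhat 4 s * Matrix.of (periodise₂ s (Kfib (toF Y) () ())) * (tipW s ρ)ᵀ) (x, α) (z, β)
      = ρ (z, β) * (periodise₂ s (Kfib (toF Y) () ()) (x + siteOf 4 s (unitVec α)) (tip s (z, β))
          - periodise₂ s (Kfib (toF Y) () ()) x (tip s (z, β))) := by
    rw [Matrix.mul_apply, Finset.sum_eq_single (tip s (z, β))]
    · rw [Matrix.transpose_apply, tipW_apply, if_pos rfl, Matrix.mul_apply]
      simp only [Matrix.of_apply, Dhat_apply_eq, sub_mul, ite_mul, one_mul, zero_mul, Finset.sum_sub_distrib, Finset.sum_ite_eq',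
        Finset.mem_univ, if_true]
      ring
    · intro z' _ hz'
      rw [Matrix.transpose_apply, tipW_apply, if_neg hz', mul_zero]
    · intro h; exact absurd (Finset.mem_univ _) h
  have rhs : periodiseF s (toF (jetCw ω Y)) (x, α) (z, β)
      = ω β (windowMap 4 s z) * (periodise₂ s (Kfib (toF Y) () ()) (siteOf 4 s (windowMap 4 s x + unitVec α)) (z + siteOf 4 s (unitVec β))
          - periodise₂ s (Kfib (toF Y) () ()) (siteOf 4 s (windowMap 4 s x)) (z + siteOf 4 s (unitVec β))) := by
    rw [periodiseF_apply]
    show (∑' m : Fin 4 → ℤ, jetCw ω Y (windowMap 4 s x) (imageShift s (windowMap 4 s z) m) α β) = _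
    simp only [jetCw_apply, hω]
    rw [tsum_mul_left, Summable.tsum_sub (hsY' _ _ _) (hsY' _ _ _), tsum_col_images_shift s hperY hrowY, tsum_col_images_shift s hperY hrowY]
  rw [lhs, Matrix.of_apply, rhs, hρ]
  simp only [tip_eq_siteOf, add_siteOf_eq, siteOf_windowMap]

include hρ hρ' in
/-- [folklore] **`Ê[ρ]·Ŷ·Ê[ρ′]ᵀ = (toF (jetRCw ω ω′ Y))^`** — the response-weighted TWO-TIP table of the torus (the second weight `ω′` `s`-periodic). -/
theorem tipW_mul_Yhat_mul_tipW_transpose (hω' : ∀ β z t, ω' β (imageShift s z t) = ω' β z) :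
    tipW s ρ * Matrix.of (periodise₂ s (Kfib (toF Y) () ())) * (tipW s ρ')ᵀ = Matrix.of (periodiseF s (toF (jetRCw ω ω' Y))) := by
  have hsY : ∀ q q' : Fin 4 → ℤ, Summable fun m => Y q (imageShift s q' m) () () := fun q q' => summable_col_images s hrowY q q'
  ext ⟨x, α⟩ ⟨z, β⟩
  have lhs : (tipW s ρ * Matrix.of (periodise₂ s (Kfib (toF Y) () ())) * (tipW s ρ')ᵀ) (x, α) (z, β)
      = ρ (x, α) * ρ' (z, β) * periodise₂ s (Kfib (toF Y) () ()) (tip s (x, α)) (tip s (z, β)) := by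
    rw [Matrix.mul_apply, Finset.sum_eq_single (tip s (z, β))]
    · rw [Matrix.transpose_apply, tipW_apply, if_pos rfl, Matrix.mul_apply, Finset.sum_eq_single (tip s (x, α))]
      · rw [tipW_apply, if_pos rfl, Matrix.of_apply]; ring
      · intro x' _ hx'; rw [tipW_apply, if_neg hx', zero_mul]
      · intro h; exact absurd (Finset.mem_univ _) h
    · intro z' _ hz'
      rw [Matrix.transpose_apply, tipW_apply, if_neg hz', mul_zero]
    · intro h; exact absurd (Finset.mem_univ _) h
  have rhs : periodiseF s (toF (jetRCw ω ω' Y)) (x, α) (z, β)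
      = ω α (windowMap 4 s x) * ω' β (windowMap 4 s z)
          * periodise₂ s (Kfib (toF Y) () ()) (siteOf 4 s (windowMap 4 s x + unitVec α)) (z + siteOf 4 s (unitVec β)) := by
    rw [periodiseF_apply]
    show (∑' m : Fin 4 → ℤ, jetRCw ω ω' Y (windowMap 4 s x) (imageShift s (windowMap 4 s z) m) α β) = _
    simp only [jetRCw_apply, hω']
    rw [tsum_mul_left, tsum_col_images_shift s hperY hrowY]
  rw [lhs, Matrix.of_apply, rhs, hρ, hρ', tip_eq_siteOf, tip_eq_siteOf, add_siteOf_eq]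

end Letters

end Summit.QuantumFields.BalabanUV.Beta.D1BFx.PackedPinnedLetters

end
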